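import Summits.PneNP.PneNP.Theses.ExpanderLinearGenerators
import Literature.Computability.MetaComplexity.LinearMapResolutionWidthProofs

/-!
# PneNP / ExpanderLinearGenerators — `ExpansionForcesDepthFregeSize` at locality `ℓ = 8`:
reduction to a Moore-type bound (stmt-PneNP-11442, helper file)

Route `PneNP/ExpanderLinearGenerators`, support item stmt-PneNP-11442
(`Summit.PneNP.PneNP.Theses.ExpanderLinearGenerators.ExpansionForcesDepthFregeSize`).

The companion file `ExpanderLinearGeneratorsExpansionForcesDepthFregeSize.lean` settles the item at
every locality `ℓ ≤ 7` (there the hypotheses are contradictory). At `ℓ = 8` unsolvable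
`(r, 6)`-boundary-expanding `8`-sparse systems DO exist (Tseitin systems of `8`-regular graphs of
large girth), but they are necessarily huge, and a huge system has huge refutations for a trivial
reason: the refuted formula is the last line of the proof. This file proves everything in that
argument except the purely combinatorial size bound, which it isolates as the hypothesis `hcore`
of `expansionForcesDepthFregeSize_eight_of_core`:

  every nonempty boundaryless row set `F` of an `8`-sparse family all of whose `≤ w`-subsets
  have `≥ 6` unique-neighbour points per row has `|F| ≥ 5 ^ ((w - 2) / 8)`

(a Moore-type bound for the row/point incidence graph; proved separately).

* `not_holds_update_add_one` — over `𝔽₂`, adding `1` to an unknown in the support of a satisfied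
  equation violates it.
* `length_equationCNF_pos` — an equation over `𝔽₂` with nonempty support has a nonempty canonical
  CNF (`B = 1` sum-encoding): some assignment violates it.
* `card_le_length_sumEncoding` — hence a system all of whose rows have nonempty support has at
  least `m` clauses in `sumEncoding 1`.
* `length_add_two_le_size_neg_ofCNF`, `length_add_two_le_proofSize` — `¬ ofCNF φ` has size
  `≥ |φ| + 2`, so every Frege proof of it has `proofSize ≥ |φ| + 2`.
* `exists_boundary_eq_empty_of_not_systemSat` — an unsolvable system over `𝔽₂` has a nonempty row
  set with empty boundary (contrapositive of the peeling lemma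
  `exists_rows_hold_of_forall_boundary_nonempty`).
* `sqrt_le_core_exponent` — the real-number bookkeeping `√r ≤ (⌊r⌋₊ - 2) / 8` for `r ≥ 100`.
* `expansionForcesDepthFregeSize_eight_of_core` — the item's statement at `ℓ = 8` (expansion
  constant written `6 = 3/4 · 8`), with `ε = 1/2`, `R = 100`, from the hypothesis `hcore`.

References: E. Ben-Sasson, A. Wigderson, *Short proofs are narrow — resolution made simple*,
J. ACM 48 (2001), §5 [BenSassonWigderson2001]; J. Krajíček, *Proof Complexity* (CUP 2019), §13.3
[KrajicekProofComplexity2019].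
-/

namespace Summit.PneNP.PneNP.Theorems

set_option linter.dupNamespace false -- `Summit.PneNP.PneNP.…`: summit = sub-problem (D-0017)

open Finset Literature.Computability.MetaComplexity Literature.Computability.Complexity

/-! ### Rows with nonempty support contribute clauses -/

/-- Over `𝔽₂`, adding `1` to an unknown in the support of a SATISFIED equation violates it
(the coefficient is `1`). [folklore] -/
theorem not_holds_update_add_one {n : ℕ} (E : LinEqMod 2 n) {z : Fin n → ZMod 2} {j : Fin n}
    (hj : j ∈ E.supp) (hz : E.Holds z) : ¬ E.Holds (Function.update z j (z j + 1)) := by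
  intro hz'
  unfold LinEqMod.Holds at hz hz'
  rw [← Finset.add_sum_erase _ _ (Finset.mem_univ j)] at hz hz'
  have hrest : ∑ j' ∈ univ.erase j, E.1 j' * Function.update z j (z j + 1) j' =
      ∑ j' ∈ univ.erase j, E.1 j' * z j' :=
    Finset.sum_congr rfl fun j' hj' => by rw [Function.update_of_ne (Finset.ne_of_mem_erase hj')]
  rw [hrest, Function.update_self] at hz'
  have ha : E.1 j = 1 :=
    (by decide : ∀ a : ZMod 2, a ≠ 0 → a = 1) _ (by simpa [LinEqMod.supp] using hj)
  rw [ha, one_mul] at hz hz'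
  have : (1 : ZMod 2) = 0 := by
    have h := hz'.trans hz.symm
    rw [add_right_comm] at h
    exact add_left_cancel (a := z j + ∑ j' ∈ univ.erase j, E.1 j' * z j') (by
      simp only [add_zero]; exact h)
  exact one_ne_zero this

/-- An equation over `𝔽₂` with NONEMPTY support is violated by some Boolean assignment under the
`B = 1` sum-encoding, hence its canonical CNF has at least one clause. [folklore] -/
theorem length_equationCNF_pos {n : ℕ} (E : LinEqMod 2 n) (hE : E.supp.Nonempty) :
    0 < (equationCNF 1 E).length := by
  obtain ⟨j, hj⟩ := hE
  -- an assignment violating `E`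
  obtain ⟨σ, hσ⟩ : ∃ σ : ℕ → Bool, ¬ E.Holds (blockVals 2 1 n σ) := by
    by_cases h0 : E.Holds (blockVals 2 1 n fun _ => false)
    · refine ⟨Function.update (fun _ => false) (j : ℕ) true, ?_⟩
      rw [blockVals_two_one_update]
      have hval : (if true = true then (1 : ZMod 2) else 0) = blockVals 2 1 n (fun _ => false) j + 1 := by
        rw [blockVals_two_one_apply]; simp
      rw [hval]
      exact not_holds_update_add_one E hj h0
    · exact ⟨fun _ => false, h0⟩
  by_contra hlen
  have hnil : equationCNF 1 E = [] := List.eq_nil_of_length_eq_zero (by omega)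
  have heval := eval_equationCNF 1 E σ
  rw [hnil, CNF.eval_nil] at heval
  exact hσ (of_decide_eq_true heval.symm)

/-- A `flatMap` over a list all of whose images are nonempty is at least as long as the list.
[folklore] -/
theorem length_le_length_flatMap {α β : Type*} {l : List α} {f : α → List β}
    (h : ∀ a ∈ l, 0 < (f a).length) : l.length ≤ (l.flatMap f).length := by
  induction l with
  | nil => simp
  | cons a l ih =>
    rw [List.flatMap_cons, List.length_append, List.length_cons]
    have h1 := h a (by simp)
    have h2 := ih fun b hb => h b (by simp [hb])
    omega

/-- **At least one clause per row.** If every row of a system over `𝔽₂` has nonempty support, its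
`B = 1` sum-encoding has at least `m` clauses. [folklore] -/
theorem card_le_length_sumEncoding {n m : ℕ} (E : Fin m → LinEqMod 2 n)
    (hE : ∀ i, (E i).supp.Nonempty) : m ≤ (sumEncoding 1 E).length := by
  have h := length_le_length_flatMap (l := List.finRange m) (f := fun k => equationCNF 1 (E k))
    fun k _ => length_equationCNF_pos (E k) (hE k)
  rwa [List.length_finRange] at h

/-! ### The refuted formula is a line of the proof -/

/-- The formula `¬ ofCNF φ` has at least `|φ| + 2` symbols (one `conj` node per clause, the final
`const true`, and the negation). [folklore] -/
theorem length_add_two_le_size_neg_ofCNF {ν : Type*} (φ : CNF ν) :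
    φ.length + 2 ≤ (PropForm.neg (PropForm.ofCNF φ)).size := by
  suffices h : φ.length + 1 ≤ (PropForm.ofCNF φ).size by
    simp only [PropForm.size]; omega
  induction φ with
  | nil => simp [PropForm.ofCNF, PropForm.size]
  | cons c φ ih =>
    simp only [PropForm.ofCNF, List.foldr_cons, PropForm.size, List.length_cons] at ih ⊢
    omega

/-- **A Frege proof is at least as large as its last line**: every `textbookFrege` proof of
`¬ ofCNF φ` has `proofSize ≥ |φ| + 2`. [Cook–Reckhow 1979, §1 (length of a proof)] [folklore] -/
theorem length_add_two_le_proofSize {φ : CNF ℕ} {π : List (PropForm ℕ)}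
    (hπ : textbookFrege.IsProofOf π (PropForm.neg (PropForm.ofCNF φ))) :
    φ.length + 2 ≤ proofSize π :=
  (length_add_two_le_size_neg_ofCNF φ).trans (by
    unfold proofSize
    exact List.le_sum_of_mem (List.mem_map.2 ⟨_, List.mem_of_getLast? hπ.2, rfl⟩))

/-! ### Unsolvable systems have a boundaryless row set -/

/-- Peeling under a hereditary boundary hypothesis (row level; Ben-Sasson–Wigderson flips): if
every nonempty subset of a row set `I` has a boundary variable then all rows of `I` have a common
solution. (Local copy of `exists_rows_hold_of_forall_boundary_nonempty` from the companion file,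
kept private while that module is unbuilt on the farm.) [BenSassonWigderson2001, Lemma 5.7]
[folklore] -/
private theorem exists_rows_hold_of_forall_boundary_nonempty_aux {n m : ℕ}
    (E : Fin m → LinEqMod 2 n) (I : Finset (Fin m))
    (hI : ∀ J ⊆ I, J.Nonempty →
      (boundary (fun i => (E i).supp.map Fin.valEmbedding) J).Nonempty) :
    ∃ σ : ℕ → Bool, ∀ i ∈ I, (E i).Holds (blockVals 2 1 n σ) := by
  induction I using Finset.strongInduction with
  | H I ih =>
    rcases I.eq_empty_or_nonempty with rfl | hne
    · exact ⟨fun _ => false, by simp⟩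
    obtain ⟨x, hx⟩ := hI I subset_rfl hne
    obtain ⟨i, hi, j, rfl, hji, huniq⟩ := exists_unique_row_of_mem_boundary E hx
    obtain ⟨σ, hσ⟩ := ih (I.erase i) (Finset.erase_ssubset hi)
      (fun J hJ hJne => hI J (hJ.trans (Finset.erase_subset _ _)) hJne)
    obtain ⟨b, hb, -⟩ := exists_flip_row E hji huniq hσ
    exact ⟨_, hb⟩


/-- **An unsolvable system over `𝔽₂` has a nonempty boundaryless row set** (contrapositive of the
peeling lemma `exists_rows_hold_of_forall_boundary_nonempty`: if every nonempty row set had a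
unique-neighbour variable the whole system would peel). [BenSassonWigderson2001, §5] [folklore] -/
theorem exists_boundary_eq_empty_of_not_systemSat {n m : ℕ} (E : Fin m → LinEqMod 2 n)
    (hunsat : ¬ SystemSat E Finset.univ) :
    ∃ F : Finset (Fin m), F.Nonempty ∧
      boundary (fun i => (E i).supp.map Fin.valEmbedding) F = ∅ := by
  by_contra hcon
  push Not at hcon
  obtain ⟨σ, hσ⟩ := exists_rows_hold_of_forall_boundary_nonempty_aux E Finset.univ
    fun J _ hJ => hcon J hJ
  exact hunsat ⟨blockVals 2 1 n σ, fun i hi => hσ i hi⟩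

/-! ### Real-number bookkeeping -/

/-- For `r ≥ 100`: `√r ≤ ((⌊r⌋₊ - 2) / 8 : ℕ)` (natural subtraction and division). Indeed
`√r ≤ r/10 ≤ (r - 10)/8` and `8 · ((⌊r⌋₊ - 2) / 8) ≥ ⌊r⌋₊ - 9 > r - 10`. [folklore] -/
theorem sqrt_le_core_exponent {r : ℝ} (hr : 100 ≤ r) :
    Real.sqrt r ≤ (((⌊r⌋₊ - 2) / 8 : ℕ) : ℝ) := by
  have hr0 : 0 ≤ r := by linarith
  -- `√r ≤ r / 10`
  have h10 : (10 : ℝ) ≤ Real.sqrt r := by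
    rw [show (10 : ℝ) = Real.sqrt 100 by
      rw [show (100 : ℝ) = 10 ^ 2 by norm_num, Real.sqrt_sq (by norm_num)]]
    exact Real.sqrt_le_sqrt hr
  have hsq : Real.sqrt r * 10 ≤ r := by
    calc Real.sqrt r * 10 ≤ Real.sqrt r * Real.sqrt r :=
          mul_le_mul_of_nonneg_left h10 (Real.sqrt_nonneg r)
      _ = r := Real.mul_self_sqrt hr0
  -- the natural-number exponent is `≥ (r - 10) / 8`
  set x : ℕ := ⌊r⌋₊ with hx
  have hxr : r < (x : ℝ) + 1 := Nat.lt_floor_add_one r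
  have hx100 : 100 ≤ x := Nat.le_floor (by exact_mod_cast hr)
  have hdiv : x - 2 ≤ 8 * ((x - 2) / 8) + 7 := by
    have := Nat.div_add_mod (x - 2) 8
    have := Nat.mod_lt (x - 2) (by norm_num : 0 < 8)
    omega
  have hcast : ((x : ℝ) - 2) ≤ 8 * ((((x - 2) / 8 : ℕ) : ℝ)) + 7 := by
    have h2 : ((x - 2 : ℕ) : ℝ) = (x : ℝ) - 2 := by
      rw [Nat.cast_sub (by omega)]; norm_num
    rw [← h2]
    exact_mod_cast hdiv
  nlinarith [hcast, hxr, hsq]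

/-! ### The reduction -/

/-- **The expansion-scale law at locality `ℓ = 8`, reduced to a Moore-type bound.** Assume
`hcore`: every nonempty boundaryless row set `F` of an `8`-sparse family whose `≤ w`-subsets all
have at least `6` unique-neighbour points per row satisfies `5 ^ ((w - 2) / 8) ≤ |F|`. Then for
every depth `d`, with `ε = 1/2` and `R = 100`: for `r ≥ R`, every unsolvable `8`-sparse system over
`𝔽₂` whose row supports form an `(r, 6)`-boundary expander (`6 = 3/4 · 8`) forces every depth-`d`
`textbookFrege` proof of `¬ sumEncoding 1 E` to have size `≥ 2 ^ (r ^ ε)`.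
Proof: an unsolvable system has a nonempty boundaryless row set `F` (peeling), so by `hcore` with
`w = ⌊r⌋₊` it has `m ≥ |F| ≥ 5 ^ ((⌊r⌋₊ - 2) / 8)` rows; expansion makes every support nonempty, so
the refuted formula — the last line of the proof — has `≥ m + 2` symbols; and
`r ^ (1/2) ≤ (⌊r⌋₊ - 2) / 8` for `r ≥ 100`. [folklore] -/
theorem expansionForcesDepthFregeSize_eight_of_core
    (hcore : ∀ {m : ℕ} (S : Fin m → Finset ℕ), (∀ i, (S i).card ≤ 8) → ∀ (w : ℕ),
      (∀ I : Finset (Fin m), I.card ≤ w → 6 * I.card ≤ (boundary S I).card) →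
      ∀ F : Finset (Fin m), F.Nonempty → boundary S F = ∅ → 5 ^ ((w - 2) / 8) ≤ F.card)
    (d : ℕ) :
    ∃ ε : ℝ, 0 < ε ∧ ∃ R : ℝ, ∀ r : ℝ, R ≤ r → ∀ (n m : ℕ) (E : Fin m → LinEqMod 2 n),
      (∀ i, (E i).supp.card ≤ 8) →
      IsBoundaryExpander (fun i => (E i).supp.map Fin.valEmbedding) r 6 →
      ¬ SystemSat E Finset.univ →
      ∀ π : List (PropForm ℕ), textbookFrege.IsDepthProofOf d π
        (PropForm.neg (PropForm.ofCNF (sumEncoding 1 E))) →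
      (2 : ℝ) ^ (r ^ ε) ≤ (proofSize π : ℝ) := by
  refine ⟨1 / 2, by norm_num, 100, fun r hr n m E hsparse hexp hunsat π hπ => ?_⟩
  have hr0 : 0 ≤ r := by linarith
  set S : Fin m → Finset ℕ := fun i => (E i).supp.map Fin.valEmbedding with hS
  set w : ℕ := ⌊r⌋₊ with hw
  -- the expansion hypothesis in natural-number form, for row sets of size `≤ w`
  have hexpN : ∀ I : Finset (Fin m), I.card ≤ w → 6 * I.card ≤ (boundary S I).card := by
    intro I hI
    have hIr : (I.card : ℝ) ≤ r :=
      (show (I.card : ℝ) ≤ (w : ℝ) by exact_mod_cast hI).trans (Nat.floor_le hr0)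
    have h := hexp I hIr
    exact_mod_cast h
  have hS8 : ∀ i, (S i).card ≤ 8 := fun i => by
    simp only [hS, Finset.card_map]; exact hsparse i
  -- a nonempty boundaryless row set, hence many rows
  obtain ⟨F, hF, hbd⟩ := exists_boundary_eq_empty_of_not_systemSat E hunsat
  have hcard : 5 ^ ((w - 2) / 8) ≤ m := by
    have h := hcore S hS8 w hexpN F hF hbd
    exact h.trans ((Finset.card_le_univ F).trans (by rw [Fintype.card_fin]))
  -- every support is nonempty (expansion of singletons, `w ≥ 1`)
  have hw1 : 1 ≤ w := Nat.le_floor (by push_cast; linarith)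
  have hsupp : ∀ i, (E i).supp.Nonempty := by
    intro i
    have h := hexpN {i} (by simpa using hw1)
    rw [Finset.card_singleton, mul_one] at h
    have hne : (boundary S {i}).Nonempty := Finset.card_pos.1 (by omega)
    obtain ⟨v, hv⟩ := hne
    have hvc : v ∈ cover S {i} := boundary_subset_cover _ hv
    rw [mem_cover] at hvc
    obtain ⟨i', hi', hvi'⟩ := hvc
    rw [Finset.mem_singleton] at hi'
    subst hi'
    simp only [hS, Finset.mem_map] at hvi'
    obtain ⟨j, hj, -⟩ := hvi'
    exact ⟨j, hj⟩
  -- the proof contains the refuted formula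
  have hsize : m + 2 ≤ proofSize π :=
    (Nat.add_le_add_right (card_le_length_sumEncoding E hsupp) 2).trans
      (length_add_two_le_proofSize hπ.1)
  -- real-number bookkeeping
  have hT : Real.sqrt r ≤ (((w - 2) / 8 : ℕ) : ℝ) := sqrt_le_core_exponent hr
  calc (2 : ℝ) ^ (r ^ (1 / 2 : ℝ)) = (2 : ℝ) ^ Real.sqrt r := by rw [Real.sqrt_eq_rpow]
    _ ≤ (2 : ℝ) ^ ((((w - 2) / 8 : ℕ) : ℝ)) :=
        Real.rpow_le_rpow_of_exponent_le (by norm_num) hT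
    _ = ((2 ^ ((w - 2) / 8) : ℕ) : ℝ) := by rw [Real.rpow_natCast]; push_cast; ring
    _ ≤ ((5 ^ ((w - 2) / 8) : ℕ) : ℝ) := by
        exact_mod_cast Nat.pow_le_pow_left (by norm_num : 2 ≤ 5) _
    _ ≤ (m : ℝ) := by exact_mod_cast hcard
    _ ≤ (proofSize π : ℝ) := by exact_mod_cast (by omega : m ≤ proofSize π)

end Summit.PneNP.PneNP.Theorems
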